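import Summits.ResolutionOfSingularities.ResolutionOfSingularities.Theorems.EquisingularLiftEquisingularLiftNatSpecimenConeVertexChart
import Summits.ResolutionOfSingularities.ResolutionOfSingularities.Theorems.EquisingularLiftEquisingularLiftNatSpecimenWhitneyCubicForms
import Literature.AlgebraicGeometry.Motives.HypersurfaceCharts
import Literature.AlgebraicGeometry.Motives.HypersurfaceChartAlgebra
import Literature.AlgebraicGeometry.Motives.SmoothHypersurfaceIrreducible
import Literature.AlgebraicGeometry.Resolution.ComponentGluing
import Literature.AlgebraicGeometry.Resolution.RegularHomReduced
import Mathlib.RingTheory.Polynomial.Basic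
import HarnessLib

/-!
# [OURS · L1 W4.5(b)] EL♮ specimens — CONES OVER PLANE CURVES, generic forms layer: the cone form `F = G(x₁, x₂, x₃) ∈ k[x₀, …, x₃]`,
# its dehomogenisations, primality, integrality of `V₊(F)`, and regularity of the chart rings
# (crux `Theses.EquisingularLift.EquisingularLiftNat`, stmt-ResolutionOfSingularities-20038)

NOT a statement of any manuscript; OURS generic lemmas (cell `res-hironaka`, chain w45b; seat res-D-pv-013, own initiative, counted 0), the
`G`-generic form of `…SpecimenFermatConeForms` (p516229) / `…FermatConeAlgebra` (p515964). AI-written, weaker than expert review.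

For a homogeneous `G ∈ k[T₀, T₁, T₂]` (the plane curve `V₊(G) ⊂ ℙ²`) the CONE over it with vertex `[1:0:0:0]` is the hypersurface
`V₊(F) ⊂ ℙ³`, `F = rename Fin.succ G = G(x₁, x₂, x₃)` (no definition: `F` is this expression throughout). This file proves:

* `isHomogeneous_rename_succ`, `finSuccEquiv_rename_succ` (`F = C(G)` in `x₀`-adic form), `prime_rename_succ` (`G` prime ⇒ `F` prime,
  Mathlib `Polynomial.prime_C_iff`), `isReduced_/isIntegral_hypersurface_cone`;
* `dehomogenize_zero_rename_succ` (`F(x₀ := 1) = G`) and `dehomogenize_succ_rename_succ` (`F(x_{i+1} := 1)` is the dehomogenisation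
  `gᵢ = G(T)|_{Tᵢ := 1}` of the base curve up to the coordinate renaming `τᵢ ∈ {id, (0 1), (0 1 2)}`);
* `isRegularRing_quotient_dehomogenize_succ`, `radical_span_dehomogenize_succ` — the off-vertex chart equations give regular (hence
  radical) quotients as soon as `k[T]/(gᵢ)` is regular;
* `rename_succ_mem_span_X_succ` (`F ∈ (x₁, x₂, x₃)`), `exists_X_succ_not_mem_span` (some `x_{a+1} ∉ (F)`: two distinct variables cannot
  both be associated to the prime `F`).

References: Hartshorne 1977 I Ex. 2.10 (cones), II Ex. 2.9, II Example 3.2.6; the cited tree files.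
-/

set_option linter.dupNamespace false -- mandated namespace `Summit.<Summit>.<Problem>` of this single-conjunct summit

noncomputable section

open MvPolynomial HomogeneousLocalization
open Literature.AlgebraicGeometry.Resolution
open Literature.AlgebraicGeometry.Motives Literature.AlgebraicGeometry.Motives.SmoothHypersurface
open Literature.AlgebraicGeometry.Motives.ProjectiveSpace

namespace Summit.ResolutionOfSingularities.ResolutionOfSingularities.Cruxes.EquisingularLiftNat.Sections

namespace Cone

variable (k : Type) [Field k] (G : MvPolynomial (Fin 3) k) {d : ℕ}

attribute [local instance] MvPolynomial.gradedAlgebra ProjBaseChange.algebraBase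

/-! ## The cone form `F = G(x₁, x₂, x₃)` -/

/-- `F = G(x₁, x₂, x₃)` is homogeneous of the same degree as `G`. [folklore] -/
theorem isHomogeneous_rename_succ (hG : G.IsHomogeneous d) : (rename Fin.succ G : MvPolynomial (Fin 4) k).IsHomogeneous d :=
  hG.rename_isHomogeneous

/-- In `x₀`-adic form `F = C(G)`: the cone form is constant in `x₀` over `k[x₁, x₂, x₃]`. [folklore] -/
theorem finSuccEquiv_rename_succ : finSuccEquiv k 3 (rename Fin.succ G) = Polynomial.C G := by
  have h := MvPolynomial.algHom_ext (A := Polynomial (MvPolynomial (Fin 3) k))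
    (f := (finSuccEquiv k 3).toAlgHom.comp (rename Fin.succ))
    (g := (Polynomial.CAlgHom : MvPolynomial (Fin 3) k →ₐ[MvPolynomial (Fin 3) k] Polynomial (MvPolynomial (Fin 3) k)).restrictScalars k
      |>.comp (Algebra.ofId _ _ |>.restrictScalars k)) fun j => by
      simp [finSuccEquiv_X_succ]
  have h' := DFunLike.congr_fun h G
  simpa using h'

/-- **`G` prime ⇒ `F = G(x₁, x₂, x₃)` prime** (`F = C(G)` in `(k[x₁,x₂,x₃])[x₀]`, Mathlib `Polynomial.prime_C_iff`). [folklore] -/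
theorem prime_rename_succ (hGp : Prime G) : Prime (rename Fin.succ G : MvPolynomial (Fin 4) k) := by
  rw [← MulEquiv.prime_iff (finSuccEquiv k 3), finSuccEquiv_rename_succ]
  exact Polynomial.prime_C_iff.mpr hGp

/-- A prime homogeneous form has positive degree. [folklore] -/
theorem pos_of_prime (hG : G.IsHomogeneous d) (hGp : Prime G) : 0 < d := by
  by_contra hd
  have hd0 : d = 0 := by omega
  subst hd0
  have hG' : G = C (G.coeff 0) := by
    rw [G.totalDegree_eq_zero_iff_eq_C.mp ?_]
    · simp
    · have := hG.totalDegree_le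
      omega
  by_cases hc : G.coeff 0 = 0
  · exact hGp.ne_zero (by rw [hG', hc, map_zero])
  · exact hGp.not_unit (by rw [hG']; exact (IsUnit.mk0 _ hc).map C)

/-! ## The dehomogenized equations -/

/-- **`F(x₀ := 1) = G`**: on the vertex chart `D₊(x₀)` (coordinates `y_j = x_{j+1}/x₀`) the cone is `V(G)`. [folklore] -/
theorem dehomogenize_zero_rename_succ : dehomogenize k (0 : Fin 4) (rename Fin.succ G) = G := by
  have h := MvPolynomial.algHom_ext (A := MvPolynomial (Fin 3) k)
    (f := (dehomogenize k (0 : Fin 4)).comp (rename Fin.succ)) (g := AlgHom.id k _) fun j => by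
      rw [AlgHom.comp_apply, rename_X, ← Fin.succAbove_zero, dehomogenize_X_succAbove, AlgHom.id_apply]
  simpa using DFunLike.congr_fun h G

/-- **`F(x₁ := 1) = g₀`**: on `D₊(x₁)` (coordinates `(x₀, x₂, x₃)/x₁`) the cone is `V(G(1, y₁, y₂))` — the dehomogenisation of the base
curve at `T₀`, with `y₀` free. [folklore] -/
theorem dehomogenize_one_rename_succ :
    dehomogenize k (1 : Fin 4) (rename Fin.succ G) = aeval (Function.update (X : Fin 3 → MvPolynomial (Fin 3) k) 0 1) G := by
  have h := MvPolynomial.algHom_ext (A := MvPolynomial (Fin 3) k)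
    (f := (dehomogenize k (1 : Fin 4)).comp (rename Fin.succ))
    (g := aeval (Function.update (X : Fin 3 → MvPolynomial (Fin 3) k) 0 1)) fun j => by
      rw [AlgHom.comp_apply, rename_X, aeval_X]
      fin_cases j
      · simp [dehomogenize_X_self]
      · simp [WhitneyCubic.dehomogenize_X_of_eq k 1 2 1 (by decide)]
      · simp [WhitneyCubic.dehomogenize_X_of_eq k 1 3 2 (by decide)]
  simpa using DFunLike.congr_fun h G

/-- **`F(x₂ := 1) = g₁` up to `y₀ ↔ y₁`**: on `D₊(x₂)` the cone is `V(G(y₁, 1, y₂))`. [folklore] -/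
theorem dehomogenize_two_rename_succ :
    dehomogenize k (2 : Fin 4) (rename Fin.succ G) =
      rename (Equiv.swap (0 : Fin 3) 1) (aeval (Function.update (X : Fin 3 → MvPolynomial (Fin 3) k) 1 1) G) := by
  have h := MvPolynomial.algHom_ext (A := MvPolynomial (Fin 3) k)
    (f := (dehomogenize k (2 : Fin 4)).comp (rename Fin.succ))
    (g := (rename (Equiv.swap (0 : Fin 3) 1)).comp (aeval (Function.update (X : Fin 3 → MvPolynomial (Fin 3) k) 1 1))) fun j => by
      rw [AlgHom.comp_apply, rename_X, AlgHom.comp_apply, aeval_X]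
      fin_cases j
      · simp [WhitneyCubic.dehomogenize_X_of_eq k 2 1 1 (by decide), Equiv.swap_apply_left]
      · simp [dehomogenize_X_self]
      · simp [WhitneyCubic.dehomogenize_X_of_eq k 2 3 2 (by decide), Equiv.swap_apply_of_ne_of_ne]
  simpa using DFunLike.congr_fun h G

/-- **`F(x₃ := 1) = g₂` up to the rotation `(0 1 2)`**: on `D₊(x₃)` the cone is `V(G(y₁, y₂, 1))`. [folklore] -/
theorem dehomogenize_three_rename_succ :
    dehomogenize k (3 : Fin 4) (rename Fin.succ G) =
      rename (finRotate 3) (aeval (Function.update (X : Fin 3 → MvPolynomial (Fin 3) k) 2 1) G) := by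
  have h := MvPolynomial.algHom_ext (A := MvPolynomial (Fin 3) k)
    (f := (dehomogenize k (3 : Fin 4)).comp (rename Fin.succ))
    (g := (rename (finRotate 3)).comp (aeval (Function.update (X : Fin 3 → MvPolynomial (Fin 3) k) 2 1))) fun j => by
      rw [AlgHom.comp_apply, rename_X, AlgHom.comp_apply, aeval_X]
      fin_cases j
      · simp [WhitneyCubic.dehomogenize_X_of_eq k 3 1 1 (by decide)]
      · simp [WhitneyCubic.dehomogenize_X_of_eq k 3 2 2 (by decide)]
      · simp [dehomogenize_X_self]
  simpa using DFunLike.congr_fun h G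

/-- For `c ≠ 0`, `F(x_c := 1)` is a coordinate renaming of the dehomogenisation `gᵢ` of the base curve at `i = c − 1`. [folklore] -/
theorem exists_dehomogenize_eq_rename (c : Fin 4) (hc : c ≠ 0) :
    ∃ (i : Fin 3) (τ : Fin 3 ≃ Fin 3), dehomogenize k c (rename Fin.succ G) =
      rename τ (aeval (Function.update (X : Fin 3 → MvPolynomial (Fin 3) k) i 1) G) := by
  fin_cases c
  · exact absurd rfl hc
  · exact ⟨0, Equiv.refl _, (dehomogenize_one_rename_succ k G).trans (by simp [rename_id])⟩
  · exact ⟨1, Equiv.swap 0 1, dehomogenize_two_rename_succ k G⟩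
  · exact ⟨2, finRotate 3, dehomogenize_three_rename_succ k G⟩

/-! ## Regularity and radicality of the chart equations -/

/-- **The off-vertex chart rings are regular**: for `c ≠ 0`, `k[y]/(F(x_c := 1))` is regular as soon as every `k[T]/(gᵢ)` is. [folklore] -/
theorem isRegularRing_quotient_dehomogenize_succ
    (hreg : ∀ i : Fin 3, IsRegularRing (MvPolynomial (Fin 3) k ⧸
      Ideal.span {aeval (Function.update (X : Fin 3 → MvPolynomial (Fin 3) k) i 1) G}))
    (c : Fin 4) (hc : c ≠ 0) :
    IsRegularRing (MvPolynomial (Fin 3) k ⧸ Ideal.span {dehomogenize k c (rename Fin.succ G)}) := by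
  obtain ⟨i, τ, hτ⟩ := exists_dehomogenize_eq_rename k G c hc
  haveI := hreg i
  have hmap : Ideal.map (renameEquiv k τ).toRingEquiv
      (Ideal.span {aeval (Function.update (X : Fin 3 → MvPolynomial (Fin 3) k) i 1) G}) =
      Ideal.span {dehomogenize k c (rename Fin.succ G)} := by
    rw [Ideal.map_span, Set.image_singleton, hτ]
    rfl
  exact IsRegularRing.of_ringEquiv (Ideal.quotientEquiv _ _ (renameEquiv k τ).toRingEquiv hmap.symm)

/-- … hence `(F(x_c := 1))` is a radical ideal for `c ≠ 0`. [folklore] -/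
theorem radical_span_dehomogenize_succ
    (hreg : ∀ i : Fin 3, IsRegularRing (MvPolynomial (Fin 3) k ⧸
      Ideal.span {aeval (Function.update (X : Fin 3 → MvPolynomial (Fin 3) k) i 1) G}))
    (c : Fin 4) (hc : c ≠ 0) :
    (Ideal.span {dehomogenize k c (rename Fin.succ G)}).radical = Ideal.span {dehomogenize k c (rename Fin.succ G)} := by
  haveI := isRegularRing_quotient_dehomogenize_succ k G hreg c hc
  haveI := IsRegularRing.isReduced' (MvPolynomial (Fin 3) k ⧸ Ideal.span {dehomogenize k c (rename Fin.succ G)})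
  exact (Ideal.isRadical_iff_quotient_reduced _).mpr inferInstance |>.radical

/-- `(F(x₀ := 1)) = (G)` is radical when `G` is prime. [folklore] -/
theorem radical_span_dehomogenize_zero (hGp : Prime G) :
    (Ideal.span {dehomogenize k (0 : Fin 4) (rename Fin.succ G)}).radical = Ideal.span {dehomogenize k (0 : Fin 4) (rename Fin.succ G)} := by
  rw [dehomogenize_zero_rename_succ]
  exact ((Ideal.span_singleton_prime hGp.ne_zero).mpr hGp).radical

/-! ## The hypersurface `V₊(F)` is integral -/

/-- `V₊(F)` (reduced induced structure) is reduced. [folklore] -/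
theorem isReduced_hypersurface_cone :
    AlgebraicGeometry.IsReduced (hypersurface (rename Fin.succ G : MvPolynomial (Fin 4) k)).left :=
  Literature.AlgebraicGeometry.Resolution.ComponentGluing.isReduced_subscheme_vanishingIdeal (zeroLocusClosed _)

/-- **The cone `V₊(G(x₁,x₂,x₃)) ⊂ ℙ³_k` over a prime plane curve is an integral scheme.** [folklore] -/
theorem isIntegral_hypersurface_cone (hG : G.IsHomogeneous d) (hGp : Prime G) :
    AlgebraicGeometry.IsIntegral (hypersurface (rename Fin.succ G : MvPolynomial (Fin 4) k)).left := by
  haveI := isReduced_hypersurface_cone k G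
  have hirr : IsIrreducible (Set.range (hypersurfaceι (rename Fin.succ G : MvPolynomial (Fin 4) k)).left) := by
    rw [range_hypersurfaceι]
    exact isIrreducible_zeroLocus_of_prime _ (isHomogeneous_rename_succ k G hG) (prime_rename_succ k G hGp)
  haveI : IrreducibleSpace (Set.range (hypersurfaceι (rename Fin.succ G : MvPolynomial (Fin 4) k)).left) :=
    Subtype.irreducibleSpace hirr
  haveI : IrreducibleSpace (hypersurface (rename Fin.succ G : MvPolynomial (Fin 4) k)).left :=
    (hypersurfaceι (rename Fin.succ G : MvPolynomial (Fin 4) k)).left.isClosedEmbedding.isEmbedding.toHomeomorph.irreducibleSpace_iff.mpr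
      this
  exact AlgebraicGeometry.isIntegral_of_irreducibleSpace_of_isReduced _

/-! ## `F ∈ (x₁, x₂, x₃)` and some `x_{a+1} ∉ (F)` -/

/-- **`F = G(x₁,x₂,x₃) ∈ (x₁, x₂, x₃)`** for `G` homogeneous of positive degree (no constant term). [folklore] -/
theorem rename_succ_mem_span_X_succ (hG : G.IsHomogeneous d) (hd : 0 < d) :
    (rename Fin.succ G : MvPolynomial (Fin 4) k) ∈
      Ideal.span (Set.range fun j : Fin 3 => (X j.succ : MvPolynomial (Fin 4) k)) := by
  classical
  have hG0 : G.coeff 0 = 0 := hG.coeff_eq_zero (by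
    rw [map_zero]
    omega)
  have hmem : G ∈ Ideal.span (Set.range (X : Fin 3 → MvPolynomial (Fin 3) k)) := by
    rw [← Set.image_univ, MvPolynomial.mem_ideal_span_X_image]
    intro m hm
    have hm0 : m ≠ 0 := by
      rintro rfl
      exact (mem_support_iff.mp hm) hG0
    obtain ⟨j, hj⟩ := Finsupp.ne_iff.mp hm0
    exact ⟨j, Set.mem_univ _, hj⟩
  have h := Ideal.mem_map_of_mem (rename (Fin.succ : Fin 3 → Fin 4) : MvPolynomial (Fin 3) k →ₐ[k] MvPolynomial (Fin 4) k) hmem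
  rw [Ideal.map_span, ← Set.range_comp] at h
  have hfun : (⇑(rename (Fin.succ : Fin 3 → Fin 4) : MvPolynomial (Fin 3) k →ₐ[k] MvPolynomial (Fin 4) k) ∘
      (X : Fin 3 → MvPolynomial (Fin 3) k)) = fun j : Fin 3 => (X j.succ : MvPolynomial (Fin 4) k) := by
    funext j
    simp [rename_X]
  rwa [hfun] at h

/-- **Some `x_{a+1}` is not a multiple of `F`** (`G` prime): else `x₁` and `x₂` would both be associated to the prime `F`. [folklore] -/
theorem exists_X_succ_not_mem_span (hGp : Prime G) :
    ∃ a : Fin 3, (X a.succ : MvPolynomial (Fin 4) k) ∉ Ideal.span {(rename Fin.succ G : MvPolynomial (Fin 4) k)} := by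
  by_contra h
  push Not at h
  have hF := prime_rename_succ k G hGp
  have h1 : (rename Fin.succ G : MvPolynomial (Fin 4) k) ∣ X (Fin.succ 0) := Ideal.mem_span_singleton.mp (h 0)
  have h2 : (rename Fin.succ G : MvPolynomial (Fin 4) k) ∣ X (Fin.succ 1) := Ideal.mem_span_singleton.mp (h 1)
  have a1 := hF.irreducible.associated_of_dvd (X_prime (i := (Fin.succ 0 : Fin 4)) (R := k)).irreducible h1
  have a2 := hF.irreducible.associated_of_dvd (X_prime (i := (Fin.succ 1 : Fin 4)) (R := k)).irreducible h2
  have a12 : Associated (X (Fin.succ 0) : MvPolynomial (Fin 4) k) (X (Fin.succ 1)) := a1.symm.trans a2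
  have hdvd := a12.dvd
  rw [X_dvd_X] at hdvd
  exact absurd hdvd (by decide)

end Cone

end Summit.ResolutionOfSingularities.ResolutionOfSingularities.Cruxes.EquisingularLiftNat.Sections

end
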